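import Literature.MathematicalPhysics.QuantumFieldTheory.Luscher2010.TrivializingMaps
import Literature.LinearAlgebra.Matrix.UnitaryGroupExpSurjective
import HarnessLib

/-!
# Lüscher's third-order Runge–Kutta integrator of the Wilson flow — the step the engine runs — typed: it maps `SU(n)^E` to itself and is gauge and translation covariant at EVERY step size, and fixes the stationary points of the flow

HONEST FRAMING: exact (Metropolis-corrected) sampling algorithms for lattice gauge theory;
figures of merit are autocorrelation/cost numbers at stated couplings and volumes; no
continuum-physics claim.

Venture `LatticeQCDFlow` (cell pub-lqcd), sub-topic `Scoring`; FANOUT row 16 (`su2-base`: 4-d `SU(2)`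
baselines scored on `τ_int(Q)` with `Q` the clover charge AFTER WILSON FLOW, and on `τ_int(t²E)`).  NEW WORK
of the cell (placement rule) over the Literature's Wilson flow (`QuantumFieldTheory/WilsonFlow`: `suProj` = `P`,
`plaquetteLoopSum` = `Ω`, `wilsonFlowVF V e = −P(Ω_e(V)) V_e`, its gauge / translation covariance lemmas
`plaquetteLoopSum_gaugeTransform`, `suProj_unitary_conj`, `plaquetteLoopSum_siteTranslate`, and the
stationary-point lemma `wilsonFlowVF_eq_zero_of_flat`), Lüscher-2010 vocabulary
(`Luscher2010/TrivializingMaps`: `suAlgebra n` = `𝔰𝔲(n)`, `wilsonGenerator`) and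
`exp(𝔰𝔲(n)) ⊆ SU(n)` (`LinearAlgebra/Matrix/UnitaryGroupExpSurjective`).  Nothing is cited as a fact; no
number.  Printed counterpart, NAMED ONLY: M. Lüscher, *Properties and uses of the Wilson flow in lattice
QCD*, JHEP 08 (2010) 071, App. C (the scheme); Munthe-Kaas / Celledoni–Marthinsen–Owren (Lie-group
Runge–Kutta methods, commutator-free low-storage form).

## Why row 16 wants it (value-free)

The row's flowed charge `Q` and its `t²E` are measured on `V_t` computed NOT by the exact flow `wilsonFlow t`
but by `m = t/ε` steps of the engine's `lc_flow_rk3_step` (latflow-core `csrc/latcore_template.c`): with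
`Zᵢ = ε Z(Wᵢ)`, `Z(U) = −TA(U R) = −P(Ω(U))`, `W₁ = e^{¼Z₀} W₀`, `W₂ = e^{8/9 Z₁ − 17/36 Z₀} W₁`,
`W₃ = e^{¾ Z₂ − 8/9 Z₁ + 17/36 Z₀} W₂`, held in two registers (`ZA = εZ(W₀)`, push `e^{ZA/4}`;
`ZB = 8/9 εZ(W₁) − 17/36 ZA`, push `e^{ZB}`; `ZA ← ¾ εZ(W₂) − ZB`, push `e^{ZA}`).  The symmetry facts the
cell uses about flowed observables were typed for the EXACT flow (`wilsonFlow_gaugeTransform`,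
`wilsonFlow_siteTranslate`, `Scoring/WilsonFlowReflectionCovariance`); this file types the integrator and
proves them for what is computed, at every finite `ε`, every `d`, `L`, `n` — no `ε → 0` argument.

## What is here

* §1 `expSU : 𝔰𝔲(n) → SU(n)` (`e^X`, the engine's `m_exp`), `expSU_neg` (`e^{−X} = (e^X)⁻¹`),
  `suConj g X = g X gᴴ ∈ 𝔰𝔲(n)`, **`expSU_suConj`** (`e^{gXgᴴ} = g e^X g⁻¹`),
  `conjTranspose_exp_mul_mul_exp` (`(e^X)ᴴ X e^X = X`).
* §2 `flowGen V e ∈ 𝔰𝔲(n)` — Lüscher's `Z(V)(e) = −P(Ω_e(V))`; `wilsonFlowVF V e = Z(V)(e)·V(e)`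
  (`wilsonFlowVF_eq_flowGen_mul`); `coe_flowGen_eq_wilsonGenerator` (= `Luscher2010.wilsonGenerator`).
* §3 the low-storage stage — `rkRegister a b ε X W = aε·Z(W) + b·X` (the engine's `flow_Z` with `Zadd`),
  `rkPush X W = (e^{X(e)} W(e))_e` (`flow_expmul`) — and **`wilsonFlowRK3 ε`**, LITERALLY the engine's three
  stages `(a, b) = (¼, 0), (8/9, −17/9), (¾, −1)`; **`wilsonFlowRK3_zero`** (`ε = 0` is the identity), **`wilsonFlowRK3_eq_self_of_wilsonFlowVF_eq_zero`** /
  `wilsonFlowRK3_eq_self_of_flat` — every stationary point of the flow (so, by `SU2CoolingFixedPoints`,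
  every cooling-stable `SU(2)` configuration) is a fixed point of the integrator AT EVERY STEP SIZE: the
  discretised flow shares the exact flow's fixed points (`wilsonFlow_eq_self_of_wilsonFlowVF_eq_zero`).
* §4 **`wilsonFlowRK3_gaugeTransform`** — `RK3_ε(V^g) = (RK3_ε V)^g` for every `g : Λ → SU(n)` and `ε`
  (registers transform by `Ad_{g(x)}`, `flowGen_gaugeTransform`; pushes by `expSU_suConj`); iterates; and
  **`isGaugeInvariant_comp_iterate_wilsonFlowRK3`**: a gauge-invariant observable of the RK3-flowed field
  (the recorded clover `Q` and `E` at flow time `mε`) is a gauge-invariant observable of the field.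
* §5 **`wilsonFlowRK3_siteTranslate`**, `iterate_wilsonFlowRK3_siteTranslate` — translation covariance.

NOT here: the reflection `Θ'` (sequel `WilsonFlowRK3Reflection`); consistency / order of the scheme as `ε → 0`; invertibility of a step; monotonicity of the action along the
discrete flow (true for the exact flow, `antitone_wilsonAction_wilsonFlow`); adaptive steps; any number.
-/

noncomputable section

open Matrix Literature.MathematicalPhysics.QuantumFieldTheory
open Literature.MathematicalPhysics.QuantumFieldTheory.Luscher2010 (wilsonGenerator AmbConfig)

namespace Summit.Ventures.LatticeQCDFlow.Scoring

variable {d L n : ℕ}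

/-! ## §1 The exponential map `𝔰𝔲(n) → SU(n)` -/

section Exp

/-- The exponential map of the Lie algebra `𝔰𝔲(n)` (the tree's `suAlgebra n`: traceless skew-Hermitian
matrices) into the group `SU(n)`, as a map of types: `expSU X = e^X`, special unitary by
`exp_mem_specialUnitaryGroup_of_mem_skewAdjoint` (`(e^X)ᴴ e^X = 1`, `det e^X = e^{tr X} = 1`).  This is the
engine's `m_exp` as applied to a flow register in `flow_expmul`. -/
def expSU (X : suAlgebra n) : Matrix.specialUnitaryGroup (Fin n) ℂ :=
  ⟨NormedSpace.exp (X : Matrix (Fin n) (Fin n) ℂ),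
    Literature.LinearAlgebra.Matrix.exp_mem_specialUnitaryGroup_of_mem_skewAdjoint
      (skewAdjoint.mem_iff.mpr (by
        rw [Matrix.star_eq_conjTranspose]
        exact ((mem_suAlgebra_iff _).mp X.2).1))
      ((mem_suAlgebra_iff _).mp X.2).2⟩

/-- `expSU X` read as a matrix is `e^X`. -/
@[simp] theorem coe_expSU (X : suAlgebra n) :
    ((expSU X : Matrix.specialUnitaryGroup (Fin n) ℂ) : Matrix (Fin n) (Fin n) ℂ) =
      NormedSpace.exp (X : Matrix (Fin n) (Fin n) ℂ) := rfl

/-- `expSU 0 = 1`. -/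
@[simp] theorem expSU_zero : expSU (0 : suAlgebra n) = 1 :=
  Subtype.ext (by rw [coe_expSU, Submodule.coe_zero, NormedSpace.exp_zero]; rfl)

/-- Elements of `𝔰𝔲(n)` are skew-Hermitian. -/
theorem conjTranspose_coe_suAlgebra (X : suAlgebra n) :
    (X : Matrix (Fin n) (Fin n) ℂ)ᴴ = -(X : Matrix (Fin n) (Fin n) ℂ) :=
  ((mem_suAlgebra_iff _).mp X.2).1

/-- Elements of `𝔰𝔲(n)` are traceless. -/
theorem trace_coe_suAlgebra (X : suAlgebra n) : (X : Matrix (Fin n) (Fin n) ℂ).trace = 0 :=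
  ((mem_suAlgebra_iff _).mp X.2).2

/-- `expSU (−X) = (expSU X)⁻¹`: `e^{−X} = e^{Xᴴ} = (e^X)ᴴ`, the inverse in `SU(n)`. -/
theorem expSU_neg (X : suAlgebra n) : expSU (-X) = (expSU X)⁻¹ := by
  apply Subtype.ext
  rw [coe_expSU, WilsonFlow.coe_inv_SU, coe_expSU, Submodule.coe_neg, ← conjTranspose_coe_suAlgebra,
    Matrix.exp_conjTranspose]

/-- Conjugating an element of `𝔰𝔲(n)` by a special unitary matrix stays in `𝔰𝔲(n)`: `g X gᴴ ∈ 𝔰𝔲(n)`. -/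
theorem conj_mem_suAlgebra (g : Matrix.specialUnitaryGroup (Fin n) ℂ) (X : suAlgebra n) :
    (g : Matrix (Fin n) (Fin n) ℂ) * (X : Matrix (Fin n) (Fin n) ℂ) * (g : Matrix (Fin n) (Fin n) ℂ)ᴴ ∈
      suAlgebra n := by
  rw [mem_suAlgebra_iff]
  refine ⟨?_, ?_⟩
  · rw [Matrix.conjTranspose_mul, Matrix.conjTranspose_mul, Matrix.conjTranspose_conjTranspose,
      conjTranspose_coe_suAlgebra]
    simp only [Matrix.mul_neg, Matrix.neg_mul, Matrix.mul_assoc]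
  · rw [Matrix.trace_mul_cycle, WilsonFlow.conjTranspose_mul_self_SU, Matrix.one_mul, trace_coe_suAlgebra]

/-- `Ad_g X = g X gᴴ` as an element of `𝔰𝔲(n)`, for `g ∈ SU(n)`. -/
def suConj (g : Matrix.specialUnitaryGroup (Fin n) ℂ) (X : suAlgebra n) : suAlgebra n :=
  ⟨(g : Matrix (Fin n) (Fin n) ℂ) * (X : Matrix (Fin n) (Fin n) ℂ) * (g : Matrix (Fin n) (Fin n) ℂ)ᴴ,
    conj_mem_suAlgebra g X⟩

/-- `suConj` read as a matrix. -/
@[simp] theorem coe_suConj (g : Matrix.specialUnitaryGroup (Fin n) ℂ) (X : suAlgebra n) :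
    ((suConj g X : suAlgebra n) : Matrix (Fin n) (Fin n) ℂ) =
      (g : Matrix (Fin n) (Fin n) ℂ) * (X : Matrix (Fin n) (Fin n) ℂ) * (g : Matrix (Fin n) (Fin n) ℂ)ᴴ := rfl

/-- `Ad_g 0 = 0`. -/ @[simp] theorem suConj_zero (g : Matrix.specialUnitaryGroup (Fin n) ℂ) : suConj g (0 : suAlgebra n) = 0 :=
  Subtype.ext (by simp)

/-- `Ad_g` is additive. -/
theorem suConj_add (g : Matrix.specialUnitaryGroup (Fin n) ℂ) (X Y : suAlgebra n) :
    suConj g (X + Y) = suConj g X + suConj g Y :=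
  Subtype.ext (by simp [Matrix.mul_add, Matrix.add_mul])

/-- `Ad_g` is `ℝ`-homogeneous. -/
theorem suConj_smul (g : Matrix.specialUnitaryGroup (Fin n) ℂ) (c : ℝ) (X : suAlgebra n) :
    suConj g (c • X) = c • suConj g X :=
  Subtype.ext (by simp)

/-- **`exp` intertwines `Ad` and conjugation**: `expSU (g X gᴴ) = g · expSU X · g⁻¹`. -/
theorem expSU_suConj (g : Matrix.specialUnitaryGroup (Fin n) ℂ) (X : suAlgebra n) :
    expSU (suConj g X) = g * expSU X * g⁻¹ := by
  apply Subtype.ext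
  have hg : IsUnit (g : Matrix (Fin n) (Fin n) ℂ) := by
    refine (Matrix.isUnit_iff_isUnit_det _).mpr ?_
    rw [(Matrix.mem_specialUnitaryGroup_iff.mp g.2).2]
    exact isUnit_one
  have hinv : (g : Matrix (Fin n) (Fin n) ℂ)⁻¹ = (g : Matrix (Fin n) (Fin n) ℂ)ᴴ :=
    Matrix.inv_eq_left_inv (WilsonFlow.conjTranspose_mul_self_SU g)
  rw [coe_expSU, coe_suConj, WilsonFlow.coe_mul_SU, WilsonFlow.coe_mul_SU, WilsonFlow.coe_inv_SU, coe_expSU,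
    ← hinv, Matrix.exp_conj _ _ hg]

/-- `e^X` commutes with `X`: `(e^X)ᴴ X e^X = X` for `X ∈ 𝔰𝔲(n)` (used to re-base the reflection transport). -/
theorem conjTranspose_exp_mul_mul_exp (X : suAlgebra n) :
    (NormedSpace.exp (X : Matrix (Fin n) (Fin n) ℂ))ᴴ * (X : Matrix (Fin n) (Fin n) ℂ) *
        NormedSpace.exp (X : Matrix (Fin n) (Fin n) ℂ) = (X : Matrix (Fin n) (Fin n) ℂ) := by
  have hc : Commute (NormedSpace.exp (X : Matrix (Fin n) (Fin n) ℂ)) (X : Matrix (Fin n) (Fin n) ℂ) :=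
    (Commute.refl (X : Matrix (Fin n) (Fin n) ℂ)).exp_left
  rw [Matrix.mul_assoc, ← hc.eq, ← Matrix.mul_assoc]
  have h1 : (NormedSpace.exp (X : Matrix (Fin n) (Fin n) ℂ))ᴴ * NormedSpace.exp (X : Matrix (Fin n) (Fin n) ℂ) = 1 :=
    WilsonFlow.conjTranspose_mul_self_SU (expSU X)
  rw [h1, Matrix.one_mul]

end Exp

/-! ## §2 The Wilson generator as an `𝔰𝔲(n)`-valued link field -/

section Generator

/-- **The Wilson-flow generator** `Z(V)(x,μ) = −P(Ω_{x,μ}(V)) ∈ 𝔰𝔲(n)` of an `SU(n)` configuration, as an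
`𝔰𝔲(n)`-valued link field (Lüscher's `Z`, the engine's `flow_Z` with `scale = −ε` divided by `ε`:
`Z = −TA(U R)`); `wilsonFlowVF V e = Z(V)(e) · V(e)` (`wilsonFlowVF_eq_flowGen_mul`) and
`Z(V)(e) = wilsonGenerator 0 (coeConfig V) e` (`coe_flowGen_eq_wilsonGenerator`). -/
def flowGen (V : GaugeConfig d L (Matrix.specialUnitaryGroup (Fin n) ℂ)) (e : Edge d L) : suAlgebra n :=
  ⟨-suProj (plaquetteLoopSum V e.1 e.2),
    (mem_suAlgebra_iff _).mpr
      ⟨by rw [Matrix.conjTranspose_neg, conjTranspose_suProj, neg_neg],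
        by rw [Matrix.trace_neg, trace_suProj, neg_zero]⟩⟩

/-- `flowGen` read as a matrix. -/
@[simp] theorem coe_flowGen (V : GaugeConfig d L (Matrix.specialUnitaryGroup (Fin n) ℂ)) (e : Edge d L) :
    ((flowGen V e : suAlgebra n) : Matrix (Fin n) (Fin n) ℂ) = -suProj (plaquetteLoopSum V e.1 e.2) := rfl

/-- The tree's flow vector field is the generator times the link: `wilsonFlowVF V e = Z(V)(e) · V(e)`. -/
theorem wilsonFlowVF_eq_flowGen_mul (V : GaugeConfig d L (Matrix.specialUnitaryGroup (Fin n) ℂ)) (e : Edge d L) :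
    wilsonFlowVF V e = ((flowGen V e : suAlgebra n) : Matrix (Fin n) (Fin n) ℂ) *
      ((V e : Matrix.specialUnitaryGroup (Fin n) ℂ) : Matrix (Fin n) (Fin n) ℂ) := rfl

/-- Dictionary with the Literature's Lüscher-2010 interface: `Z(V)(e)` is the (time-independent) Wilson
generator `wilsonGenerator` evaluated on the configuration read in the ambient matrix space. -/
theorem coe_flowGen_eq_wilsonGenerator (V : GaugeConfig d L (Matrix.specialUnitaryGroup (Fin n) ℂ)) (e : Edge d L) :
    ((flowGen V e : suAlgebra n) : Matrix (Fin n) (Fin n) ℂ) = wilsonGenerator 0 (WilsonFlow.coeConfig V) e := by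
  rw [coe_flowGen, wilsonGenerator, WilsonFlow.loopSumAmb_coeConfig]

/-- `Z(V)(e) = 0` iff the flow vector field vanishes at `e` (the link variable is invertible). -/
theorem flowGen_eq_zero_iff (V : GaugeConfig d L (Matrix.specialUnitaryGroup (Fin n) ℂ)) (e : Edge d L) :
    flowGen V e = 0 ↔ wilsonFlowVF V e = 0 := by
  rw [wilsonFlowVF_eq_flowGen_mul]
  constructor
  · intro h
    rw [h, Submodule.coe_zero, Matrix.zero_mul]
  · intro h
    apply Subtype.ext
    have h2 := congrArg (· * ((V e : Matrix.specialUnitaryGroup (Fin n) ℂ) : Matrix (Fin n) (Fin n) ℂ)ᴴ) h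
    simp only [Matrix.mul_assoc, WilsonFlow.mul_conjTranspose_self_SU, Matrix.mul_one, Matrix.zero_mul] at h2
    rw [h2, Submodule.coe_zero]

end Generator

/-! ## §3 Low-storage Lie–Euler stages and Lüscher's scheme -/

section Scheme

/-- **Register update** of a low-storage (Williamson-type) Lie-group Runge–Kutta stage with coefficients
`(a, b)` and step size `ε`: the new `𝔰𝔲(n)`-valued register is `X'(e) = a ε · Z(W)(e) + b · X(e)`, `W` the
current field and `X` the previous register (the engine's `flow_Z(…, scale = −aε, Zadd = X, add = b)`). -/
def rkRegister (a b ε : ℝ) (X : Edge d L → suAlgebra n)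
    (W : GaugeConfig d L (Matrix.specialUnitaryGroup (Fin n) ℂ)) : Edge d L → suAlgebra n :=
  fun e => (a * ε) • flowGen W e + b • X e

/-- **Exponential push**: every link is multiplied on the left by the exponential of its register,
`W'(e) = e^{X(e)} W(e)` (the engine's `flow_expmul`). -/
def rkPush (X : Edge d L → suAlgebra n) (W : GaugeConfig d L (Matrix.specialUnitaryGroup (Fin n) ℂ)) :
    GaugeConfig d L (Matrix.specialUnitaryGroup (Fin n) ℂ) :=
  fun e => expSU (X e) * W e

/-- **Lüscher's third-order integrator of the Wilson flow, one step of size `ε`** — LITERALLY the engine's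
`lc_flow_rk3_step` (latflow-core `csrc/latcore_template.c`): with `Zᵢ = ε Z(Wᵢ)`,
`W₁ = exp(¼ Z₀) W₀`, `W₂ = exp(8/9 Z₁ − 17/36 Z₀) W₁`, `W₃ = exp(¾ Z₂ − 8/9 Z₁ + 17/36 Z₀) W₂`
[Lüscher, JHEP 08 (2010) 071, App. C], written in the two-register form the code uses: registers
`X₁ = ¼ ε Z(W₀)`, `X₂ = 8/9 ε Z(W₁) − 17/9 X₁`, `X₃ = ¾ ε Z(W₂) − X₂`, each pushed by `rkPush`. -/
def wilsonFlowRK3 (ε : ℝ) (V : GaugeConfig d L (Matrix.specialUnitaryGroup (Fin n) ℂ)) :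
    GaugeConfig d L (Matrix.specialUnitaryGroup (Fin n) ℂ) :=
  let X₁ := rkRegister (1 / 4) 0 ε (fun _ => 0) V
  let W₁ := rkPush X₁ V
  let X₂ := rkRegister (8 / 9) (-17 / 9) ε X₁ W₁
  let W₂ := rkPush X₂ W₁
  let X₃ := rkRegister (3 / 4) (-1) ε X₂ W₂
  rkPush X₃ W₂

/-- Pushing the zero register does nothing. -/
@[simp] theorem rkPush_zero (W : GaugeConfig d L (Matrix.specialUnitaryGroup (Fin n) ℂ)) :
    rkPush (fun _ => (0 : suAlgebra n)) W = W := by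
  funext e
  simp [rkPush]

/-- A register built from a field with vanishing generator and a zero previous register is zero. -/
theorem rkRegister_eq_zero {a b ε : ℝ} {W : GaugeConfig d L (Matrix.specialUnitaryGroup (Fin n) ℂ)}
    (hW : ∀ e, flowGen W e = 0) : rkRegister a b ε (fun _ => 0) W = fun _ => 0 := by
  funext e
  simp [rkRegister, hW e]

/-- At step size `0` every register vanishes … -/
theorem rkRegister_zero_step (a b : ℝ) (W : GaugeConfig d L (Matrix.specialUnitaryGroup (Fin n) ℂ)) :
    rkRegister a b 0 (fun _ => (0 : suAlgebra n)) W = fun _ => 0 := by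
  funext e
  simp [rkRegister]

/-- … so **`wilsonFlowRK3 0 = id`**. -/
@[simp] theorem wilsonFlowRK3_zero (V : GaugeConfig d L (Matrix.specialUnitaryGroup (Fin n) ℂ)) :
    wilsonFlowRK3 0 V = V := by
  simp only [wilsonFlowRK3, rkRegister_zero_step, rkPush_zero]

/-- **Stationary points of the flow are fixed points of the integrator, at every step size**: if the flow
vector field vanishes at `V` (`P(Ω_e(V)) = 0` on every link — e.g. flat configurations, or the
cooling-stable `SU(2)` configurations of `SU2CoolingFixedPoints`), then `wilsonFlowRK3 ε V = V`; with the
Literature's `wilsonFlow_eq_self_of_wilsonFlowVF_eq_zero` the discretised and the exact flow share these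
fixed points. -/
theorem wilsonFlowRK3_eq_self_of_wilsonFlowVF_eq_zero {V : GaugeConfig d L (Matrix.specialUnitaryGroup (Fin n) ℂ)}
    (h : ∀ e, wilsonFlowVF V e = 0) (ε : ℝ) : wilsonFlowRK3 ε V = V := by
  have hZ : ∀ e, flowGen V e = 0 := fun e => (flowGen_eq_zero_iff V e).mpr (h e)
  simp only [wilsonFlowRK3, rkRegister_eq_zero hZ, rkPush_zero]

/-- Flat configurations (all plaquette holonomies trivial) are fixed by the integrator. -/
theorem wilsonFlowRK3_eq_self_of_flat {V : GaugeConfig d L (Matrix.specialUnitaryGroup (Fin n) ℂ)}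
    (hV : ∀ x μ ν, μ ≠ ν → plaquetteHolonomy V x μ ν = 1) (ε : ℝ) : wilsonFlowRK3 ε V = V :=
  wilsonFlowRK3_eq_self_of_wilsonFlowVF_eq_zero (wilsonFlowVF_eq_zero_of_flat hV) ε

end Scheme

/-! ## §4 Gauge covariance -/

section Gauge

variable (g : Site d L → Matrix.specialUnitaryGroup (Fin n) ℂ)

/-- How an `𝔰𝔲(n)`-valued link register transforms under a gauge transformation `g`: by `Ad_{g(x)}` at the
starting point `x` of each link, `X(x,μ) ↦ g(x) X(x,μ) g(x)ᴴ`. -/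
def gaugeReg (X : Edge d L → suAlgebra n) : Edge d L → suAlgebra n := fun e => suConj (g e.1) (X e)

/-- The zero register is gauge invariant. -/
@[simp] theorem gaugeReg_zero : gaugeReg g (fun _ => (0 : suAlgebra n)) = fun _ => 0 := by
  funext e
  simp [gaugeReg]

/-- **The generator is gauge covariant in the adjoint sense**: `Z(V^g)(x,μ) = g(x) Z(V)(x,μ) g(x)ᴴ`
(`Ω_{x,μ}` is conjugated at its base point and `P` commutes with unitary conjugation). -/
theorem flowGen_gaugeTransform (V : GaugeConfig d L (Matrix.specialUnitaryGroup (Fin n) ℂ)) :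
    flowGen (gaugeTransform g V) = gaugeReg g (flowGen V) := by
  funext e
  obtain ⟨x, μ⟩ := e
  apply Subtype.ext
  have hg : ((g x : Matrix.specialUnitaryGroup (Fin n) ℂ) : Matrix (Fin n) (Fin n) ℂ) ∈
      Matrix.unitaryGroup (Fin n) ℂ := (g x).2.1
  rw [gaugeReg, coe_suConj, coe_flowGen, coe_flowGen, plaquetteLoopSum_gaugeTransform,
    ← Matrix.star_eq_conjTranspose, suProj_unitary_conj hg]
  simp only [Matrix.mul_neg, Matrix.neg_mul]

/-- Register updates are gauge covariant. -/
theorem rkRegister_gaugeTransform (a b ε : ℝ) (X : Edge d L → suAlgebra n)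
    (W : GaugeConfig d L (Matrix.specialUnitaryGroup (Fin n) ℂ)) :
    rkRegister a b ε (gaugeReg g X) (gaugeTransform g W) = gaugeReg g (rkRegister a b ε X W) := by
  funext e
  simp only [rkRegister, gaugeReg, flowGen_gaugeTransform g W, suConj_add, suConj_smul]

/-- Exponential pushes are gauge covariant: `e^{g X gᴴ} · (g W h⁻¹) = g · (e^X W) · h⁻¹`. -/
theorem rkPush_gaugeTransform (X : Edge d L → suAlgebra n) (W : GaugeConfig d L (Matrix.specialUnitaryGroup (Fin n) ℂ)) :
    rkPush (gaugeReg g X) (gaugeTransform g W) = gaugeTransform g (rkPush X W) := by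
  funext e
  simp only [rkPush, gaugeReg, gaugeTransform, expSU_suConj]
  group

/-- **Gauge covariance of the integrator at every step size**: `RK3_ε(V^g) = (RK3_ε V)^g` for every
`g : Λ → SU(n)`, every `ε ∈ ℝ`, every `d`, `L`, `n`. -/
theorem wilsonFlowRK3_gaugeTransform (ε : ℝ) (V : GaugeConfig d L (Matrix.specialUnitaryGroup (Fin n) ℂ)) :
    wilsonFlowRK3 ε (gaugeTransform g V) = gaugeTransform g (wilsonFlowRK3 ε V) := by
  simp only [wilsonFlowRK3]
  conv_lhs => rw [← gaugeReg_zero g]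
  simp only [rkRegister_gaugeTransform, rkPush_gaugeTransform]

/-- The same for any number of steps (flow time `m ε`). -/
theorem iterate_wilsonFlowRK3_gaugeTransform (ε : ℝ) (m : ℕ)
    (V : GaugeConfig d L (Matrix.specialUnitaryGroup (Fin n) ℂ)) :
    (wilsonFlowRK3 ε)^[m] (gaugeTransform g V) = gaugeTransform g ((wilsonFlowRK3 ε)^[m] V) :=
  Function.Commute.iterate_left (fun U => wilsonFlowRK3_gaugeTransform g ε U) m V

omit g in
/-- **Gauge-invariant observables of the RK3-flowed field are gauge-invariant observables of the field**
(e.g. the flowed clover charge and clover energy the engine records after `m` steps). -/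
theorem isGaugeInvariant_comp_iterate_wilsonFlowRK3 {α : Type*}
    {F : GaugeConfig d L (Matrix.specialUnitaryGroup (Fin n) ℂ) → α} (hF : IsGaugeInvariant F) (ε : ℝ) (m : ℕ) :
    IsGaugeInvariant (F ∘ (wilsonFlowRK3 ε)^[m]) := fun g U => by
  simp only [Function.comp_apply, iterate_wilsonFlowRK3_gaugeTransform, hF g]

end Gauge

/-! ## §5 Translation covariance -/

section Translation

variable (a : Site d L)

/-- A translated register: `X ↦ X(· + a)`. -/
def transReg (X : Edge d L → suAlgebra n) : Edge d L → suAlgebra n := fun e => X (e.1 + a, e.2)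

/-- The zero register is translation invariant. -/
@[simp] theorem transReg_zero : transReg a (fun _ => (0 : suAlgebra n)) = fun _ => 0 := rfl

/-- The generator commutes with lattice translations. -/
theorem flowGen_siteTranslate (V : GaugeConfig d L (Matrix.specialUnitaryGroup (Fin n) ℂ)) :
    flowGen (V.siteTranslate a) = transReg a (flowGen V) := by
  funext e
  apply Subtype.ext
  rw [transReg, coe_flowGen, coe_flowGen, plaquetteLoopSum_siteTranslate]

/-- Register updates commute with translations. -/
theorem rkRegister_siteTranslate (a' b ε : ℝ) (X : Edge d L → suAlgebra n)
    (W : GaugeConfig d L (Matrix.specialUnitaryGroup (Fin n) ℂ)) :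
    rkRegister a' b ε (transReg a X) (W.siteTranslate a) = transReg a (rkRegister a' b ε X W) := by
  funext e
  simp only [rkRegister, transReg, flowGen_siteTranslate a W]

/-- Exponential pushes commute with translations. -/
theorem rkPush_siteTranslate (X : Edge d L → suAlgebra n) (W : GaugeConfig d L (Matrix.specialUnitaryGroup (Fin n) ℂ)) :
    rkPush (transReg a X) (W.siteTranslate a) = (rkPush X W).siteTranslate a := by
  funext e
  simp only [rkPush, transReg, GaugeConfig.siteTranslate_apply]

/-- **Translation covariance of the integrator**: `RK3_ε(τ_a V) = τ_a(RK3_ε V)`. -/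
theorem wilsonFlowRK3_siteTranslate (ε : ℝ) (V : GaugeConfig d L (Matrix.specialUnitaryGroup (Fin n) ℂ)) :
    wilsonFlowRK3 ε (V.siteTranslate a) = (wilsonFlowRK3 ε V).siteTranslate a := by
  simp only [wilsonFlowRK3]
  conv_lhs => rw [← transReg_zero a]
  simp only [rkRegister_siteTranslate, rkPush_siteTranslate]

/-- The same for any number of steps. -/
theorem iterate_wilsonFlowRK3_siteTranslate (ε : ℝ) (m : ℕ)
    (V : GaugeConfig d L (Matrix.specialUnitaryGroup (Fin n) ℂ)) :
    (wilsonFlowRK3 ε)^[m] (V.siteTranslate a) = ((wilsonFlowRK3 ε)^[m] V).siteTranslate a :=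
  Function.Commute.iterate_left (fun U => wilsonFlowRK3_siteTranslate a ε U) m V

end Translation


end Summit.Ventures.LatticeQCDFlow.Scoring

end
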